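/-
Origin: expansion seat `planner-pub-hodgecm-pv01-g2-0`, handover #4 2026-08-18T05:07:16Z (`HOME/pub-hodgecm-pv01-g2/lean/Pv01g2/RealApproximationGlue.lean`, md5 9bd6454f, 88 lines);
landed by the gen-6 packager in gate run 22 as `HodgeCM/PerL34/RealApproximationGlue.lean` (import ^import Pv[0-9]+g[0-9]+\.→import HodgeCM.PerL34. ×1; stripped 1 #print/#check/#eval lines).
-/
/-
Copyright: pub-hodgecm formalisation cell (harness21, 2026). New file (not vendored).
Origin: HOME/pub-hodgecm-pv01-g2/lean/Pv01g2/RealApproximationGlue.lean (WIP module `Pv01g2.RealApproximationGlue`;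
intended final place `HodgeCM/PerL34/RealApproximationGlue.lean` = module `HodgeCM.PerL34.RealApproximationGlue`;
import rewrite on landing `Pv01g2.RealApproximationBall` → `HodgeCM.PerL34.RealApproximationBall`).
(seat planner-pub-hodgecm-pv01-g2-0; node N33 / N33e ball route, PerL v5 Prop 4.3 ll. 672–677.)
-/
import Summits.HodgeConjecture.HodgeCM.PerL34.BallGlue
import Summits.HodgeConjecture.HodgeCM.PerL34.RealApproximationBall

/-!
# Ball route with `Dense Δ` DISCHARGED (assembly only; no new mathematics)

`BallGlue.n33e_ball`, `BallGlue.BallFormsModel.stepsPrint_of_ball` and the residual-input record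
`BallGlue.BallStepsInput` carry the PRINT binder `Dense (Δ : Set U21)` (real approximation, PerL ll. 672–677).
With `HodgeCM.PerL34.RealApproximation.dense_Delta` that binder is a THEOREM as soon as `Δ` is what PerL says it is —
the image of `G_U(L₀)` in `U(2,1)`, i.e. `Δ = RealApproximation.Delta V T hT` for a frame `T` at `ι₁`.  This file
records the BY-NAME joins:

* `n33e_ball_delta` — `n33e_ball` for `Δ := Delta V T hT`, no density hypothesis;
* `BallFormsModel.stepsPrint_of_delta` — `stepsPrint_of_ball` with `hΔ` replaced by the DICTIONARY identity
  `B.Δ = Delta V T hT`;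
* `BallStepsInputΔ T` — the residual input of node N33 over the ball model with the conjunct `Dense B.Δ` (PRINT)
  replaced by `B.Δ = Delta V T hT` (DEFINITIONAL: "`Δ` is the image of `G_U(L₀)`", LEMMAS §3 D2), and
  `ballStepsInput_of_delta : BallStepsInputΔ T → BallStepsInput T`, whence `open_thetaWedge_of_ballStepsΔ`.
-/

set_option autoImplicit false

noncomputable section

namespace HodgeCM
namespace PerL34
namespace BallGlue

open HodgeCM.PerL34.WedgeNonvanishing HodgeCM.PerL34.WedgeToClasses HodgeCM.PerL34.BallModel
open HodgeCM.PerL34.RealApproximation (Delta dense_Delta)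
open scoped Matrix

variable {L : CMField} {ι₁ : L →+* ℂ}

/-- **N33e on the ball, density discharged**: `n33e_ball` for `Δ :=` the image of `G_U(L₀)` (`Delta V T hT`). -/
theorem n33e_ball_delta (h : N33eClosed) (V : HermSpace3 L ι₁) (T : GL3)
    (hT : (T : Matrix (Fin 3) (Fin 3) ℂ)ᴴ * V.Hm.map ι₁ * (T : Matrix (Fin 3) (Fin 3) ℂ) = J)
    (𝒰₁ 𝒰₂ : Submodule ℂ (Ball → (Fin 2 → ℂ))) (h₁ : ∀ u ∈ 𝒰₁, Continuous u) (h₂ : ∀ u ∈ 𝒰₂, Continuous u)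
    (s₁ : StableUnder (Delta V T hT) A 𝒰₁) (s₂ : StableUnder (Delta V T hT) A 𝒰₂) (n₁ : 𝒰₁ ≠ ⊥) (n₂ : 𝒰₂ ≠ ⊥) :
    ∃ u₁ ∈ 𝒰₁, ∃ u₂ ∈ 𝒰₂, ∃ x : Ball, LinearIndependent ℂ ![u₁ x, u₂ x] :=
  n33e_ball h (Delta V T hT) (dense_Delta V T hT) 𝒰₁ 𝒰₂ h₁ h₂ s₁ s₂ n₁ n₂

variable {U : Universe} {V : HermSpace3 L ι₁}

/-- `stepsPrint_of_ball` with the PRINT binder `hΔ` replaced by the dictionary identity `B.Δ = Delta V T hT`. -/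
theorem BallFormsModel.stepsPrint_of_delta (B : BallFormsModel U V) (T : GL3)
    (hT : (T : Matrix (Fin 3) (Fin 3) ℂ)ᴴ * V.Hm.map ι₁ * (T : Matrix (Fin 3) (Fin 3) ℂ) = J)
    (hB : B.Δ = Delta V T hT) (hc : N33c_statement B.Δ A B.gen₁ B.gen₂)
    (ha₁ : ∀ d, B.allowed₁ d) (ha₂ : ∀ d, B.allowed₂ d) : B.toFormsModelT.StepsPrint :=
  B.stepsPrint_of_ball hc (hB ▸ dense_Delta V T hT) ha₁ ha₂

variable (T : U.ThetaModel)

/-- The residual input of node N33 over the ball model, with `Dense Δ` (PRINT) replaced by the DEFINITIONAL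
`B.Δ = Delta V Tfr hT` ("`Δ` is the image of `G_U(L₀)` in `U(2,1)`", for some frame `Tfr` at `ι₁`). -/
def BallStepsInputΔ : Prop :=
  ∀ {L : CMField} {ι₁ : L →+* ℂ} (V : HermSpace3 L ι₁) (c : SeesawCtx L), T.GoodCtx ι₁ c →
    ∃ (Tfr : GL3) (hT : (Tfr : Matrix (Fin 3) (Fin 3) ℂ)ᴴ * V.Hm.map ι₁ * (Tfr : Matrix (Fin 3) (Fin 3) ℂ) = J)
      (B : BallFormsModel U V), B.Δ = Delta V Tfr hT ∧ N33c_statement B.Δ A B.gen₁ B.gen₂ ∧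
      (∀ d, B.allowed₁ d) ∧ (∀ d, B.allowed₂ d) ∧ B.toFormsModelT.Dict_thetaClass₀ T c ∧
      B.toFormsModelT.Dict_thetaClass₁ T c ∧ B.toFormsModelT.toFormsModel.Dict_cupWedge

/-- `Dense Δ` is no longer an input: `BallStepsInputΔ T → BallStepsInput T`. -/
theorem ballStepsInput_of_delta (h : BallStepsInputΔ T) : BallStepsInput T := by
  intro L ι₁ V c hc
  obtain ⟨Tfr, hT, B, hB, hN33c, ha₁, ha₂, h₀, h₁, hcup⟩ := h V c hc
  exact ⟨B, hN33c, hB ▸ dense_Delta V Tfr hT, ha₁, ha₂, h₀, h₁, hcup⟩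

/-- **A6 over the ball model without the real-approximation input**: `Open_thetaWedge` from `LevelDirected`
(PROVED), `N33eClosed` (PROVED, pv01) and `BallStepsInputΔ T`. -/
theorem open_thetaWedge_of_ballStepsΔ (hLD : LevelDirected) (hE : N33eClosed) (h : BallStepsInputΔ T) :
    T.Open_thetaWedge :=
  open_thetaWedge_of_ballSteps T hLD hE (ballStepsInput_of_delta T h)

end BallGlue
end PerL34
end HodgeCM

end

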